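import Literature.Computability.Complexity.LundEtAl1992Proofs
import Literature.Computability.Complexity.CookReducibilityTransitive
import Literature.Computability.Complexity.PRelHierarchy
import Literature.Computability.Complexity.TodaPartOne
import Literature.Computability.Complexity.TodaPartTwo
import Literature.Computability.Complexity.CountingProofs
import HarnessLib

/-!
# `PH ⊆ IP` and `coNP ⊆ IP`: proof of Lund–Fortnow–Karloff–Nisan's Corollary 2 (`LundEtAl1992_cor2_holds`)

Topic `Computability/Complexity`, namespace `Literature.Computability.Complexity`.

Discharge of the named fact `LundEtAl1992_cor2 : PH ⊆ IP ∧ coNP ⊆ IP` (`LundEtAl1992.lean`),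
exactly along the printed derivation (Lund–Fortnow–Karloff–Nisan 1992, p. 861: "Together with
Toda's result that `P^{#P}` contains all the languages of the polynomial-time hierarchy [32],
Theorem 1 implies: COROLLARY 2. Every language in the polynomial-time hierarchy has an interactive
proof system. In particular, every language in co-NP has an interactive proof system."):

* `PRelClass_PP_subset_PSharpP` — `P^{PP} ⊆ P^{#P}`: an oracle machine with a `PP` oracle `A`
  is re-run with the `#P` function oracle deciding `A` (`PP_subset_PSharpP_holds`,
  `CountingProofs.lean`), by the composition of polynomial-time oracle machines
  (`mem_PRel_of_polyTimeTuringReducible_holds`, `CookReducibilityTransitive.lean`)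
  (Arora–Barak 2009, §17.2.1, proof of Lemma 17.7: `P^{PP} = P^{#P}`).
* `PH_subset_PSharpP` — Toda's theorem in the form the corollary consumes, `PH ⊆ P^{#P}`: the
  tree's two proved halves `Σₖᵖ ⊆ BPₑ·⊕P` (`SigmaP_subset_bpExp_ParityP_holds`, `TodaPartOne.lean`)
  and `BP·⊕P ⊆ P^{PP}` (`bp_ParityP_subset_PRelClass_PP_holds`, `TodaPartTwo.lean`), assembled by
  `PH_subset_PRelClass_PP_of_parts` (`ParityQuantifier.lean`), then `P^{PP} ⊆ P^{#P}`.
* `coNP_subset_PSharpP` — `coNP ⊆ P^{#P}`: `NP ⊆ P^{#P}` (`NP_subset_PSharpP_holds`) and `P^f` is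
  closed under complement (`compl_mem_PRel`).
* `PH_subset_IP`, `coNP_subset_IP` — the two clauses, from Theorem 1 (`LundEtAl1992_thm1_holds`,
  `LundEtAl1992Proofs.lean`); `LundEtAl1992_cor2_holds` is their conjunction.

No new definition and no new named fact is introduced.

## References

* C. Lund, L. Fortnow, H. Karloff, N. Nisan, *Algebraic methods for interactive proof systems*,
  J. ACM 39(4) (1992) 859–868, Thm. 1 and Cor. 2 (p. 861).
* S. Toda, *PP is as hard as the polynomial-time hierarchy*, SIAM J. Comput. 20(5) (1991)
  865–877, Main Theorem.
* S. Arora, B. Barak, *Computational Complexity: A Modern Approach*, CUP 2009, Thm. 17.14 and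
  Lemma 17.7 (§17.2.1).
-/

noncomputable section

namespace Literature.Computability.Complexity

/-- **`P^{PP} ⊆ P^{#P}`.** If `L ∈ P^A` with `A ∈ PP`, then `A ∈ P^f` for some `f ∈ #P`
(`PP_subset_PSharpP_holds`), and composing the two polynomial-time oracle machines
(`mem_PRel_of_polyTimeTuringReducible_holds`, valid for an arbitrary oracle, here the function
oracle `Oracle.ofFun f`) gives `L ∈ P^f ⊆ P^{#P}`. (Arora–Barak 2009, §17.2.1, proof of Lemma 17.7:
"`P^{PP} = P^{#P}`"; only this inclusion is used by Corollary 2.) [cite: AroraBarak2009, Lemma 17.7 (proof, §17.2.1)] -/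
theorem PRelClass_PP_subset_PSharpP : PRelClass PP ⊆ PSharpP := by
  intro L hL
  obtain ⟨A, hA, hLA⟩ := mem_PRelClass_iff.1 hL
  obtain ⟨f, hf, hAf⟩ := Set.mem_iUnion₂.1 (PP_subset_PSharpP_holds hA)
  exact Set.mem_iUnion₂.2 ⟨f, hf, mem_PRel_of_polyTimeTuringReducible_holds hLA hAf⟩

/-- **Toda's theorem, `P^{#P}` form: `PH ⊆ P^{#P}`** ("Toda's result that `P^{#P}` contains all
the languages of the polynomial-time hierarchy", LFKN p. 861): `PH ⊆ BP·⊕P ⊆ P^{PP}` by the tree's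
two proved halves (`SigmaP_subset_bpExp_ParityP_holds`, `bp_ParityP_subset_PRelClass_PP_holds`,
assembled by `PH_subset_PRelClass_PP_of_parts`), then `P^{PP} ⊆ P^{#P}`
(`PRelClass_PP_subset_PSharpP`). [cite: Toda1991, Main Theorem] [cite: AroraBarak2009, Thm. 17.14] -/
theorem PH_subset_PSharpP : PH ⊆ PSharpP :=
  (PH_subset_PRelClass_PP_of_parts SigmaP_subset_bpExp_ParityP_holds
    bp_ParityP_subset_PRelClass_PP_holds).trans PRelClass_PP_subset_PSharpP

/-- **`coNP ⊆ P^{#P}`**: for `L ∈ coNP`, `Lᶜ ∈ NP ⊆ P^f` for some `f ∈ #P`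
(`NP_subset_PSharpP_holds`), and `P^f` is closed under complement (`compl_mem_PRel`).
[cite: AroraBarak2009, §17.2] -/
theorem coNP_subset_PSharpP : coNP ⊆ PSharpP := by
  intro L hL
  have hLc : Lᶜ ∈ Nondeterministic.NP := hL
  obtain ⟨f, hf, hLf⟩ := Set.mem_iUnion₂.1 (NP_subset_PSharpP_holds hLc)
  have hL' : L ∈ PRel (Oracle.ofFun f) := by
    have h := compl_mem_PRel hLf
    rwa [compl_compl] at h
  exact Set.mem_iUnion₂.2 ⟨f, hf, hL'⟩

/-- **`PH ⊆ IP`** (Lund–Fortnow–Karloff–Nisan 1992, Corollary 2, first clause): Toda's theorem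
`PH ⊆ P^{#P}` (`PH_subset_PSharpP`) with Theorem 1, `P^{#P} ⊆ IP` (`LundEtAl1992_thm1_holds`).
[cite: LundEtAl1992, Cor. 2 (p. 861)] -/
theorem PH_subset_IP : PH ⊆ IP :=
  PH_subset_PSharpP.trans LundEtAl1992_thm1_holds

/-- **`coNP ⊆ IP`** (Lund–Fortnow–Karloff–Nisan 1992, Corollary 2, second clause: "In particular,
every language in co-NP has an interactive proof system"): `coNP ⊆ P^{#P} ⊆ IP`
(`coNP_subset_PSharpP`, `LundEtAl1992_thm1_holds`). [cite: LundEtAl1992, Cor. 2 (p. 861)] -/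
theorem coNP_subset_IP : coNP ⊆ IP :=
  coNP_subset_PSharpP.trans LundEtAl1992_thm1_holds

/-- **Lund–Fortnow–Karloff–Nisan 1992, Corollary 2, discharged: `PH ⊆ IP ∧ coNP ⊆ IP`**
(`LundEtAl1992_cor2`), from Theorem 1 (`LundEtAl1992_thm1_holds`) and Toda's theorem
(`PH_subset_PSharpP`), as printed. [cite: LundEtAl1992, Cor. 2 (p. 861)] [cite: Toda1991, Main Theorem] -/
theorem LundEtAl1992_cor2_holds : LundEtAl1992_cor2 :=
  ⟨PH_subset_IP, coNP_subset_IP⟩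

end Literature.Computability.Complexity

end
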